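import Summits.AtomisticToContinuum.FouriersLaw.Theses.PorousMediumCorner
import HarnessLib

/-!
# BC3 birth skeleton of the piece `AnchorNoDrudeWeight` (child of the split of `PorousMediumCorner.AnchorAbelGreenKubo`, stmt-AtomisticToContinuum-9790)

Seam: the Drude weight `σ{0}` of a finite spectral measure is the CESÀRO MEAN of its cosine transform (Wiener's lemma,
stub 2, pure harmonic analysis, provable now), so "no Drude weight" is the time-domain Mazur / mean-ergodic statement
"the time average of the summed current autocorrelation vanishes" (stub 1, the physics: no flow-invariant odd `L²` charge
overlaps the current).

`AnchorNoDrudeWeight` below is a LOCAL copy of the child's statement (byte-identical with children.json / the registered stub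
`stub_anchorNoDrudeWeight` of `Lines/spectral_trichotomy.lean`); after the split it is the route decl
`Summit.AtomisticToContinuum.FouriersLaw.Theses.PorousMediumCorner.AnchorNoDrudeWeight` and `AnchorNoDrudeWeight_of` retargets to it by name.
lean check: rc 0, sorries = the two stubs, `AnchorNoDrudeWeight_of` uses the stubs BY NAME.
-/

noncomputable section

namespace Summit.AtomisticToContinuum.FouriersLaw.Cruxes.AnchorAbelGreenKubo.BirthNoDrudeWeight

open MeasureTheory Filter Set Topology
open scoped ENNReal NNReal

/-- Local copy of the piece (see the module docstring). -/
def AnchorNoDrudeWeight : Prop :=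
  ∀ μ γ : ℝ, 0 < μ → ∀ (ρ : MeasureTheory.Measure Literature.MathematicalPhysics.KineticTheory.HeatConduction.ChainConfig) (D : Literature.MathematicalPhysics.KineticTheory.HeatConduction.InfiniteChainDynamics (Literature.MathematicalPhysics.KineticTheory.HeatConduction.OscillatorChain.mk (fun q => μ * q ^ 4 / 4) (fun r => r ^ 4 / 4) γ)), (Literature.MathematicalPhysics.KineticTheory.HeatConduction.OscillatorChain.mk (fun q => μ * q ^ 4 / 4) (fun r => r ^ 4 / 4) γ).IsChainGibbsMeasure 1 ρ → (∀ x : ℤ, MeasureTheory.MeasurePreserving (fun σ : Literature.MathematicalPhysics.KineticTheory.HeatConduction.ChainConfig => fun i : ℤ => σ (i + x)) ρ ρ) → D.PreservesMeasure ρ → (∀ t : ℝ, D.HasAbsConvergentCorrelation ρ t) → ∀ σ : MeasureTheory.Measure ℝ, MeasureTheory.IsFiniteMeasure σ → (∀ t : ℝ, D.currentCorrelation ρ t = MeasureTheory.integral σ (fun ω : ℝ => Real.cos (ω * t))) → σ {0} = 0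

/-- **Stub 1 (physics; Mazur / mean-ergodic form).** For every admissible representation of the anchor at `T = 1`, the
Cesàro mean of the summed current autocorrelation vanishes: `τ⁻¹ ∫₀^τ C(t) dt → 0` — the current class has zero
hydrodynamic projection in `ℋ₀(ρ)` (von Neumann's mean ergodic theorem identifies the limit with `‖P_{ker L}[J]‖²`;
Suzuki–Mazur). [cite: Doyon2022, Thm 5.1] -/
theorem stub_cesaroMeanZero :
    ∀ μ γ : ℝ, 0 < μ → ∀ (ρ : MeasureTheory.Measure Literature.MathematicalPhysics.KineticTheory.HeatConduction.ChainConfig) (D : Literature.MathematicalPhysics.KineticTheory.HeatConduction.InfiniteChainDynamics (Literature.MathematicalPhysics.KineticTheory.HeatConduction.OscillatorChain.mk (fun q => μ * q ^ 4 / 4) (fun r => r ^ 4 / 4) γ)), (Literature.MathematicalPhysics.KineticTheory.HeatConduction.OscillatorChain.mk (fun q => μ * q ^ 4 / 4) (fun r => r ^ 4 / 4) γ).IsChainGibbsMeasure 1 ρ → (∀ x : ℤ, MeasureTheory.MeasurePreserving (fun σ : Literature.MathematicalPhysics.KineticTheory.HeatConduction.ChainConfig => fun i : ℤ => σ (i +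 x)) ρ ρ) → D.PreservesMeasure ρ → (∀ t : ℝ, D.HasAbsConvergentCorrelation ρ t) → Filter.Tendsto (fun τ : ℝ => τ⁻¹ * ∫ t in (0:ℝ)..τ, D.currentCorrelation ρ t) Filter.atTop (nhds 0) := by
  sorry

/-- **Stub 2 (harmonic analysis; Wiener's lemma for the atom at `0`, provable now).** For a finite measure `σ` on `ℝ` with
cosine transform `C(t) = ∫ cos(ωt) dσ(ω)`: `τ⁻¹ ∫₀^τ C(t) dt = ∫ sinc(ωτ) dσ(ω) → σ{0}` as `τ → ∞` (Fubini; dominated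
convergence, `|sinc| ≤ 1`, `sinc(ωτ) → 𝟙_{ω = 0}`). [folklore] -/
theorem stub_atom_eq_cesaroLimit :
    ∀ (σ : MeasureTheory.Measure ℝ) (C : ℝ → ℝ), MeasureTheory.IsFiniteMeasure σ →
      (∀ t : ℝ, C t = MeasureTheory.integral σ (fun ω : ℝ => Real.cos (ω * t))) →
      Filter.Tendsto (fun τ : ℝ => τ⁻¹ * ∫ t in (0:ℝ)..τ, C t) Filter.atTop (nhds (σ {0}).toReal) := by
  sorry

/-- **`AnchorNoDrudeWeight_of`**: the two stubs give the piece — both limits are limits of the same function of `τ`,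
so `(σ{0}).toReal = 0`, and `σ{0} ≠ ⊤` for a finite measure. [folklore] -/
theorem AnchorNoDrudeWeight_of : AnchorNoDrudeWeight := by
  intro μ γ hμ ρ D hG hS hP hA σ hfin hC
  haveI : IsFiniteMeasure σ := hfin
  have l1 := stub_cesaroMeanZero μ γ hμ ρ D hG hS hP hA
  have l2 := stub_atom_eq_cesaroLimit σ (D.currentCorrelation ρ) hfin hC
  have h0 : (σ {0}).toReal = 0 := tendsto_nhds_unique l2 l1
  rw [ENNReal.toReal_eq_zero_iff] at h0
  exact h0.resolve_right (measure_ne_top σ _)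

end Summit.AtomisticToContinuum.FouriersLaw.Cruxes.AnchorAbelGreenKubo.BirthNoDrudeWeight

end
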